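import Summits.AtomisticToContinuum.Crystallization.Theorems.FreeSplittingCertificatesStrictSplittingRuleP1CellEndpointFold
import Summits.AtomisticToContinuum.Crystallization.Theorems.FreeSplittingCertificatesStrictSplittingRuleP1FarShares

/-!
# `StrictSplittingRule` (stmt-AtomisticToContinuum-12560): THE CELL'S ENDPOINT WITH THE FAR SHARES PINNED — the shed set `φ` is the only readout datum (P1 interpolant object, part 76)

Route `FreeSplittingCertificates`, crux r3 `StrictSplittingRule` (H12⋆ = `stub_coreJointCoercive`), unit b2b-freesplit-B gen 34.
VALUE = part 74 with the interface far-share data INSTANTIATED by the functions of part 75 (`w p = p1FarW a h (φ p) p`, `wv p = p1FarWv a h (φ p) p`,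
`sv p = (2,0,0)`, `LEG p = p1FarLegs (φ p) p`) and their five side conditions (`hw, hws, hwv, hwvs, hwfar`) DISCHARGED in the kernel:
**`coreJointCoercive_cell_of_certificates₅`** — `CoreJointCoercive a h (1/3) (1/12)` on the `HcpFamilyMin` box from, per representative, the shed set `φ p`
(to be pinned to `matched25c.json` 'phi0': 308 legs per parity) and the routing offsets `o p` (3 per site, in a finite set `S`), the free tables `QB/L/U`,
`PAYM`, and FIVE certificate-tier statements: (B∃) the per-cell budget with the exact defect for SOME allocations of the pinned shares, (S), (TAB), (PAY),
(NC∃) the near certificate with the exact collar flux for SOME stencilled near tables — each now a statement about `φ`, the tables and the lattice only.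
What G9b still pins: `φ` (2 × 308 legs), `o`/`S` (the slanted vertical route of `budget25.py`), `QB/L/U` (2 × ≈ 1 158 sites incl. the 168/170 inner reach sites,
HOME FAR-LEMMA-SPEC §24 (f)), `PAYM` (2 × 12).  NOT a proof of H12⋆ (five certificate-tier hypotheses, verified outside the kernel; tiers in HOME CERT §34 (d)),
NOT summit progress.  [folklore]
-/

noncomputable section

open Set Function Metric MeasureTheory Filter Topology
open scoped BigOperators NNReal ENNReal Classical

namespace Summit.AtomisticToContinuum.Crystallization.Theorems.StrictSplittingRuleBirth

open Literature.MathematicalPhysics.StatisticalMechanics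
open Summit.AtomisticToContinuum.Crystallization.Theorems.PalmUnimodularRigidity.LayeredLawsSelectHcp

/-- **THE CELL'S ENDPOINT WITH THE FAR SHARES PINNED.**  See the module docstring.
NOT a proof of H12⋆ ((B∃), (S), (TAB), (PAY), (NC∃) are hypotheses verified outside the kernel), NOT summit progress. -/
theorem coreJointCoercive_cell_of_certificates₅ {a h : ℝ} (ha : 0 < a) (hh : 0 < h) (hfam : HcpFamilyMin a h)
    -- per representative: the SHED SET of the matched readout rule (the only far-share datum), and the routing offsets of the vertical bond
    (φ : (ℤ × ℤ × ℤ) → Finset ((ℤ × ℤ × ℤ) × (ℤ × ℤ × ℤ)))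
    (o : (ℤ × ℤ × ℤ) → (ℤ × ℤ × ℤ) → Fin 3 → ℤ × ℤ × ℤ) (S : Finset (ℤ × ℤ × ℤ))
    (ho : ∀ p ∈ ({(0, 0, 0), (1, 0, 0)} : Finset (ℤ × ℤ × ℤ)), ∀ q i, o p q i ∈ S)
    -- (B∃) THE PER-CELL BUDGET at each representative, exact-defect form, FOR SOME allocation tables (witness data folded in)
    (hB : ∀ p ∈ ({(0, 0, 0), (1, 0, 0)} : Finset (ℤ × ℤ × ℤ)),
      ∃ θ θv : (ℤ × ℤ × ℤ) × (ℤ × ℤ × ℤ) → (ℤ × ℤ × ℤ) × Fin 6 → ℝ,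
        (∀ e T, 0 ≤ θ e T) ∧ (∀ e, (Function.support (θ e)).Finite) ∧ (∀ T, (Function.support fun e => θ e T).Finite) ∧
        (∀ e, p1FarW a h (φ p) p e ≠ 0 → ∑ᶠ T, θ e T = 1) ∧
        (∀ e T, θ e T ≠ 0 → ∃ m m' : Fin 4, e.1 = T.1 + p1VertOff (p1Par T.1) T.2 m ∧
          e.1 + e.2 = T.1 + p1VertOff (p1Par T.1) T.2 m') ∧
        (∀ e T, 0 ≤ θv e T) ∧ (∀ e, (Function.support (θv e)).Finite) ∧ (∀ T, (Function.support fun e => θv e T).Finite) ∧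
        (∀ e, (∑ i : Fin 3, (2 / 3) * ((if e.2 = o p e.1 i then p1FarWv a h (φ p) p e.1 else 0) +
          (if o p (e.1 - (p1SV - e.2)) i = p1SV - e.2 then p1FarWv a h (φ p) p (e.1 - (p1SV - e.2)) else 0))) ≠ 0 → ∑ᶠ T, θv e T = 1) ∧
        (∀ e T, θv e T ≠ 0 → ∃ m m' : Fin 4, e.1 = T.1 + p1VertOff (p1Par T.1) T.2 m ∧
          e.1 + e.2 = T.1 + p1VertOff (p1Par T.1) T.2 m') ∧
        ∀ (T : (ℤ × ℤ × ℤ) × Fin 6) (G : Fin 3 → Fin 3 → ℝ),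
      (∑ᶠ e : (ℤ × ℤ × ℤ) × (ℤ × ℤ × ℤ), θ e T * p1FarW a h (φ p) p e *
          fpSq (fun k => (hcpSite a h (e.1 + e.2) 0 - hcpSite a h e.1 0) * G 0 k +
            (hcpSite a h (e.1 + e.2) 1 - hcpSite a h e.1 1) * G 1 k + (hcpSite a h (e.1 + e.2) 2 - hcpSite a h e.1 2) * G 2 k)) +
      (∑ᶠ e : (ℤ × ℤ × ℤ) × (ℤ × ℤ × ℤ), θv e T *
          (∑ i : Fin 3, (2 / 3) * ((if e.2 = o p e.1 i then p1FarWv a h (φ p) p e.1 else 0) +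
            (if o p (e.1 - (p1SV - e.2)) i = p1SV - e.2 then p1FarWv a h (φ p) p (e.1 - (p1SV - e.2)) else 0))) *
          fpSq (fun k => (hcpSite a h (e.1 + e.2) 0 - hcpSite a h e.1 0) * G 0 k +
            (hcpSite a h (e.1 + e.2) 1 - hcpSite a h e.1 1) * G 1 k + (hcpSite a h (e.1 + e.2) 2 - hcpSite a h e.1 2) * G 2 k)) +
      p1CellDefectG a h (fun y k l => (193 / 125) * ((7 * (5 / 4 : ℝ) + 3 / 4) / 4) * fpChi ((81 / 20 * a) ^ 2) ((27 / 5 * a) ^ 2) (y - fun k => hcpSite a h p k) ^ 2 *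
          (fpSq (y - fun k => hcpSite a h p k))⁻¹ ^ 5 * ((y - fun k => hcpSite a h p k) k * (y - fun k => hcpSite a h p k) l)) T G ≤
      (193 / 125) * ((5 / 2 * (1 / 24 * fpSymSq G) + 5 / 2 * (1 / 24 * (fpFrob G - fpSymSq G))) *
        ∫ y in p1RealCell a h T, fpChi ((81 / 20 * a) ^ 2) ((27 / 5 * a) ^ 2) (y - fun k => hcpSite a h p k) ^ 2 * (fpSq (y - fun k => hcpSite a h p k))⁻¹ ^ 3))
    -- (S) per-site domination off the reach set, (TAB) the hat-average tables on it
    (QB : (ℤ × ℤ × ℤ) → Finset (ℤ × ℤ × ℤ)) (L U : (ℤ × ℤ × ℤ) → (ℤ × ℤ × ℤ) → ℝ)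
    (hS : ∀ p ∈ ({(0, 0, 0), (1, 0, 0)} : Finset (ℤ × ℤ × ℤ)), ∀ q : ℤ × ℤ × ℤ, q ∉ QB p → q ≠ p → ∀ z : Fin 3 → ℝ,
      0 ≤ 1 / 2 * (ljSqDeriv (‖hcpSite a h q - hcpSite a h p‖ ^ 2) * fpSq z +
          2 * (1 / 2 * (7 * ((‖hcpSite a h q - hcpSite a h p‖ ^ 2)⁻¹) ^ 8 -
            4 * ((‖hcpSite a h q - hcpSite a h p‖ ^ 2)⁻¹) ^ 5)) * p1NRad a h p (fun _ => z) q ^ 2) +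
        p1SiteBare a h (fun y k l => (193 / 125) * ((7 * (5 / 4 : ℝ) + 3 / 4) / 4) * fpChi ((81 / 20 * a) ^ 2) ((27 / 5 * a) ^ 2) (y - fun k => hcpSite a h p k) ^ 2 *
          (fpSq (y - fun k => hcpSite a h p k))⁻¹ ^ 5 * ((y - fun k => hcpSite a h p k) k * (y - fun k => hcpSite a h p k) l)) (fun _ => z) q -
        p1SiteBare a h (fun y k l => (193 / 125) * ((3 / 4 : ℝ) / 4) * fpChi ((81 / 20 * a) ^ 2) ((27 / 5 * a) ^ 2) (y - fun k => hcpSite a h p k) ^ 2 *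
          (fpSq (y - fun k => hcpSite a h p k))⁻¹ ^ 4 * (if k = l then 1 else 0)) (fun _ => z) q)
    (hTab : ∀ p ∈ ({(0, 0, 0), (1, 0, 0)} : Finset (ℤ × ℤ × ℤ)), ∀ q ∈ QB p, q ≠ p → ∀ z : Fin 3 → ℝ,
      L p q * p1NRad a h p (fun _ => z) q ^ 2 ≤
        p1SiteBare a h (fun y k l => (193 / 125) * ((7 * (5 / 4 : ℝ) + 3 / 4) / 4) * fpChi ((81 / 20 * a) ^ 2) ((27 / 5 * a) ^ 2) (y - fun k => hcpSite a h p k) ^ 2 *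
          (fpSq (y - fun k => hcpSite a h p k))⁻¹ ^ 5 * ((y - fun k => hcpSite a h p k) k * (y - fun k => hcpSite a h p k) l)) (fun _ => z) q ∧
      p1SiteBare a h (fun y k l => (193 / 125) * ((3 / 4 : ℝ) / 4) * fpChi ((81 / 20 * a) ^ 2) ((27 / 5 * a) ^ 2) (y - fun k => hcpSite a h p k) ^ 2 *
          (fpSq (y - fun k => hcpSite a h p k))⁻¹ ^ 4 * (if k = l then 1 else 0)) (fun _ => z) q ≤ U p q * fpSq z)
    -- (PAY) the far table's column-sum enclosures
    (PAYM : (ℤ × ℤ × ℤ) → (ℤ × ℤ × ℤ) → ℝ)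
    (hPAY : ∀ p ∈ ({(0, 0, 0), (1, 0, 0)} : Finset (ℤ × ℤ × ℤ)), ∀ s ∈ p1BondOffsets, (193 / 125) * (2 / 5) / a ^ 4 *
      (∑' q : ℤ × ℤ × ℤ, p1RecTable a h (p1SplitDensity (81 / 20 * a) (27 / 5 * a)) (decide (Even p.1)) (q - p) s) ≤ PAYM p s)
    -- (NC∃) THE NEAR CERTIFICATE WITH THE EXACT COLLAR FLUX at both representatives, FOR SOME stencilled decaying finitely supported near tables
    (hNC : ∃ M₁ N : Bool → (ℤ × ℤ × ℤ) → (ℤ × ℤ × ℤ) → (ℤ × ℤ × ℤ) → ℝ, ∃ QT : (ℤ × ℤ × ℤ) → Finset (ℤ × ℤ × ℤ),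
      (∀ b d s s', s ∉ p1BondOffsets ∨ s' ∉ p1BondOffsets → M₁ b d s s' = 0 ∧ N b d s s' = 0) ∧
      (∃ C₁ : ℝ, ∀ p q : ℤ × ℤ × ℤ, ∀ s s', |M₁ (decide (Even p.1)) (q - p) s s'| ≤
        C₁ * ((1 + ‖hcpSite a h q - hcpSite a h p‖)⁻¹) ^ 6 ∧
      |N (decide (Even p.1)) (q - p) s s'| ≤ C₁ * ((1 + ‖hcpSite a h q - hcpSite a h p‖)⁻¹) ^ 6) ∧
      (∀ p ∈ ({(0, 0, 0), (1, 0, 0)} : Finset (ℤ × ℤ × ℤ)), ∀ q : ℤ × ℤ × ℤ, q ∉ QT p → ∀ s s',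
      M₁ (decide (Even p.1)) (q - p) s s' = 0 ∧ M₁ (decide (Even q.1)) (p - q) s s' = 0 ∧
      N (decide (Even p.1)) (q - p) s s' = 0 ∧ N (decide (Even q.1)) (p - q) s' s = 0) ∧
      ∀ p ∈ ({(0, 0, 0), (1, 0, 0)} : Finset (ℤ × ℤ × ℤ)), ∀ V : ℤ × ℤ × ℤ → (Fin 3 → ℝ), V p = 0 →
      (∀ Z : Fin 3 → Fin 3 → ℝ, (∀ j k, Z j k = -Z k j) →
        ∑ q ∈ (if Even p.1 then hcpStarIdx.image (fun d => d + p) else hcpStarIdx.image (fun d => p - d)), ∑ k : Fin 3, V q k * (∑ j : Fin 3, (hcpSite a h q j - hcpSite a h p j) * Z j k) = 0) →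
      0 ≤ p1NearForm a h (1 / 3) (1 / 12) (193 / 125) p p1Stencil (p1Beta a h) M₁ N (p1FarW a h (φ p) p) p1SV (p1FarWv a h (φ p) p) (fun s => -p1Beta a h (decide (Even p.1)) 0 s) (if Even p.1 then hcpStarIdx.image (fun d => d + p) else hcpStarIdx.image (fun d => p - d)) (QB p) (QT p) ∅ (p1FarLegs (φ p) p) (L p) (U p) (PAYM p) (fun _ => 0) (fun _ _ => 0) V -
        193 / 125 * p1ExactFluxSum a h p V) :
    CoreJointCoercive a h (1 / 3) (1 / 12)  := by
  obtain ⟨hlo, hhi⟩ := ratioBox_of_hcpFamilyMin ha hh hfam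
  obtain ⟨hA, _⟩ := hcpFamilyMin_enclosure ha hh hfam
  have hha : h ≤ a := by linarith
  have hlo' : 3 / 4 * a ≤ h := by linarith
  have ha2 : 1 ≤ 2 * a := by rw [abs_le] at hA; linarith [hA.1]
  exact coreJointCoercive_cell_of_certificates₄ ha hh hfam (fun p e => p1FarW a h (φ p) p e)
    (fun p _ e => p1FarW_nonneg ha hh hha ha2 (φ p) p e) (fun p _ => summable_p1FarW_load ha hh (φ p) p) (fun _ => p1SV) o S ho
    (fun p q => p1FarWv a h (φ p) p q) (fun p _ q => p1FarWv_nonneg ha hh hha ha2 (φ p) p q) (fun p _ => summable_p1FarWv ha hh (φ p) p)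
    hB QB L U hS hTab (fun p => p1FarLegs (φ p) p) (fun p _ e he => p1Far_hwfar ha hlo' hha ha2 (φ p) p e he) PAYM hPAY hNC

end Summit.AtomisticToContinuum.Crystallization.Theorems.StrictSplittingRuleBirth

end
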